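import Literature.InformationTheory.QuantumCodes.QuantumExpanderFlipVariants
import HarnessLib

/-!
# Quantum expander codes: Leverrier–Tillich–Zémor 2015 Lemma 8 — a small set with syndrome decrease at
# least a third of its size exists (the four-case analysis of App. B) — PROOF

Topic `Literature/InformationTheory/QuantumCodes` (venture QEC; step 2 of 3). Source: LTZ15 =
arXiv:1504.00822v1: Lemma 8 (p0008 L104-110) and App. B (p0013 L10 - p0014 L50): the Hamming-reduced
representative and eq. (reduced) `|x_a ∪ x_b| ≤ (Δ_A+Δ_B)/2`, the reduced variables `x, x̄, z, y, ȳ, t`,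
the integrality refinement `z ≤ 1/3 − 1/(3Δ_B)`, `t ≤ 1/3 − 1/(3Δ_A)` (eq. (bound-z-t)), eqs. (partial),
(partial2) and the four cases.

* `ltz_four_cases` — the arithmetic: one of the flips `x_a ∪ x_b`, `x̄_a ∪ x̄_b`, `x_a ∪ x_b ∪ χ_a ∪ χ_b`
  has decrease `≥` (its size)`/3`;
* `exists_smallSet_decrease_third` — **LTZ15 Lemma 8 (decrease clause), PROVED**: `e ∉ C_Z^⊥`,
  `|e| ≤ γ_A n_A`, `|e| ≤ γ_B n_B` (biregular, `δ_A, δ_B < 1/6`) ⇒ some `F ∈ 𝓕` has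
  `|σ_X(e)| − |σ_X(e ⊕ F)| ≥ |F|/3`. The reduced-weight clause `w_R(e+e₁) ≤ w_R(e)` of the printed lemma
  is not needed for Theorem 2 and is not asserted.
-/

namespace Literature.InformationTheory.QuantumCodes

namespace QuantumExpander

open Finset Matrix

variable {A B : Type*} [Fintype A] [Fintype B] [DecidableEq A] [DecidableEq B]

/-! ### LTZ15 Lemma 8 (existence of a flip with ratio ≥ 1/3): the four-case analysis -/

/-- **The arithmetic of LTZ15 App. B (proof of Lemma 8)**, all four cases at once. Variables: `X = |x_a|`,
`Xb = |x̄_a|`, `Za = |χ_a|` (so `X + Xb + Za = Δ_B`), `Y = |x_b|`, `Yb = |x̄_b|`, `Zb = |χ_b|`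
(`Y + Yb + Zb = Δ_A`); integrality of the bounds `|χ_a| < Δ_B/3`, `|χ_b| < Δ_A/3` ("`3zΔ_B ≤ 3Δ_B − 1`");
reducedness `|x_a ∪ x_b| ≤ (Δ_A + Δ_B)/2` (eq. (reduced)); `P ≥` eq. (partial), `Q ≥` eq. (partial2).
Conclusion: one of the three flips `x_a ∪ x_b`, `x̄_a ∪ x̄_b`, `x_a ∪ x_b ∪ χ_a ∪ χ_b` (sizes `X + Y`,
`Xb + Yb`, `Δ_A + Δ_B − Xb − Yb`; the last two have decrease `Q`) decreases the syndrome weight by at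
least a third of its size. [cite: LeverrierTillichZemor2015, App. B, the four cases (arXiv v1 p0013 L91-149, p0014 L1-50)] -/
theorem ltz_four_cases {dA dB X Xb Za Y Yb Zb P Q : ℝ} (hdA : 0 < dA) (hdB : 0 < dB)
    (hX : 0 ≤ X) (hXb : 0 ≤ Xb) (hY : 0 ≤ Y) (hYb : 0 ≤ Yb)
    (hrow : X + Xb + Za = dB) (hcol : Y + Yb + Zb = dA)
    (hZa3 : 3 * Za + 1 ≤ dB) (hZb3 : 3 * Zb + 1 ≤ dA) (hred : 2 * (X + Y) ≤ dA + dB)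
    (hP : X * Yb + Xb * Y - X * Zb - Za * Y ≤ P) (hQ : X * Yb + Xb * Y - Xb * Zb - Za * Yb ≤ Q) :
    X + Y ≤ 3 * P ∨ Xb + Yb ≤ 3 * Q ∨ dA + dB - Xb - Yb ≤ 3 * Q := by
  by_cases h1 : 3 * (X * dA + Y * dB) ≤ 2 * (dA * dB)
  · -- Case 1: `x + y ≤ 2/3`
    left
    have hYb' : Yb = dA - Y - Zb := by linarith
    have hXb' : Xb = dB - X - Za := by linarith
    have hP' : X * dA + Y * dB - 2 * X * Y - 2 * X * Zb - 2 * Za * Y ≤ P := by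
      rw [hYb', hXb'] at hP; linarith
    -- `2XY ≤ (X dA + Y dB)/3`
    have hamgm : 4 * (X * dA) * (Y * dB) ≤ (X * dA + Y * dB) ^ 2 := by
      nlinarith [sq_nonneg (X * dA - Y * dB)]
    have hS0 : 0 ≤ X * dA + Y * dB := by positivity
    have hsq : (X * dA + Y * dB) ^ 2 ≤ 2 * (dA * dB) / 3 * (X * dA + Y * dB) := by
      have := mul_le_mul_of_nonneg_left h1 hS0
      nlinarith
    have hxy : 2 * X * Y ≤ (X * dA + Y * dB) / 3 := by
      have hd : 0 < dA * dB := mul_pos hdA hdB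
      have h4 : 4 * (X * Y) * (dA * dB) ≤ 2 * (dA * dB) / 3 * (X * dA + Y * dB) := by nlinarith
      have h5 : 4 * (X * Y) ≤ 2 / 3 * (X * dA + Y * dB) := by
        have := div_le_div_of_nonneg_right h4 hd.le
        rw [mul_div_assoc, div_self hd.ne', mul_one] at this
        calc 4 * (X * Y) ≤ 2 * (dA * dB) / 3 * (X * dA + Y * dB) / (dA * dB) := this
          _ = 2 / 3 * (X * dA + Y * dB) := by field_simp
      linarith
    have hZb' : 2 * X * Zb ≤ 2 * X * ((dA - 1) / 3) := by
      have : Zb ≤ (dA - 1) / 3 := by linarith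
      nlinarith
    have hZa' : 2 * Za * Y ≤ 2 * ((dB - 1) / 3) * Y := by
      have : Za ≤ (dB - 1) / 3 := by linarith
      nlinarith
    nlinarith
  · by_cases h2 : X ≤ Xb ∧ Y ≤ Yb
    · -- Case 2: flip `x_a ∪ x_b`
      left
      have hYb2 : 1 / 2 ≤ Yb - Zb := by linarith [h2.2]
      have hXb2 : 1 / 2 ≤ Xb - Za := by linarith [h2.1]
      have hP' : X * (Yb - Zb) + Y * (Xb - Za) ≤ P := by linarith
      nlinarith [mul_le_mul_of_nonneg_left hYb2 hX, mul_le_mul_of_nonneg_left hXb2 hY]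
    · by_cases h3 : Xb < X ∧ Yb < Y
      · -- Case 3: flip `x̄_a ∪ x̄_b`
        right; left
        have hX2 : 1 / 2 ≤ X - Za := by linarith [h3.1]
        have hY2 : 1 / 2 ≤ Y - Zb := by linarith [h3.2]
        have hQ' : Yb * (X - Za) + Xb * (Y - Zb) ≤ Q := by linarith
        nlinarith [mul_le_mul_of_nonneg_left hX2 hYb, mul_le_mul_of_nonneg_left hY2 hXb]
      · -- Case 4: mixed signs
        have hmix : (X - Xb) * (Y - Yb) ≤ 0 := by
          by_cases hx : X ≤ Xb
          · have hy : Yb < Y := by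
              by_contra hy
              push Not at hy
              exact h2 ⟨hx, hy⟩
            nlinarith [mul_nonneg (sub_nonneg.2 hx) (sub_nonneg.2 hy.le)]
          · push Not at hx
            have hy : Y ≤ Yb := by
              by_contra hy
              push Not at hy
              exact h3 ⟨hx, hy⟩
            nlinarith [mul_nonneg (sub_nonneg.2 hx.le) (sub_nonneg.2 hy)]
        have hsum : dA + dB + 1 ≤ 3 * (P + Q) := by
          have h2XY : (X + Xb) * (Y + Yb) ≤ 2 * (X * Yb) + 2 * (Xb * Y) := by nlinarith
          have hPQ : 2 * (X * Yb) + 2 * (Xb * Y) - (X + Xb) * Zb - (Y + Yb) * Za ≤ P + Q := by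
            nlinarith
          have hA : dB + 1 ≤ 2 * dB - 3 * Za := by linarith
          have hB : dA + 1 ≤ 2 * dA - 3 * Zb := by linarith
          have hprod : (dB + 1) * (dA + 1) ≤ (2 * dB - 3 * Za) * (2 * dA - 3 * Zb) := by
            have h0 : 0 ≤ dB + 1 := by linarith
            have h0' : 0 ≤ dA + 1 := by linarith
            calc (dB + 1) * (dA + 1) ≤ (2 * dB - 3 * Za) * (dA + 1) :=
                  mul_le_mul_of_nonneg_right hA h0'
              _ ≤ (2 * dB - 3 * Za) * (2 * dA - 3 * Zb) :=
                  mul_le_mul_of_nonneg_left hB (by linarith)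
          have hXXb : X + Xb = dB - Za := by linarith
          have hYYb : Y + Yb = dA - Zb := by linarith
          rw [hXXb, hYYb] at hPQ h2XY
          nlinarith
        by_cases h4 : dA + dB + 1 ≤ 6 * P
        · left; linarith
        · have hQ6 : dA + dB + 1 ≤ 6 * Q := by linarith
          by_cases h5 : 2 * (Xb + Yb) ≤ dA + dB
          · right; left; linarith
          · right; right; linarith

omit [DecidableEq A] [DecidableEq B] in
/-- `|v| = |E ∩ A²| + |E ∩ B²|`. [folklore] -/
private theorem hammingNorm_eq_cardA_add_cardB (v : (A × A) ⊕ (B × B) → ZMod 2) :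
    hammingNorm v
      = (univ.filter fun p : A × A => v (Sum.inl p) ≠ 0).card
        + (univ.filter fun p : B × B => v (Sum.inr p) ≠ 0).card := by
  simp only [hammingNorm]
  rw [Finset.card_filter, Finset.card_filter, Finset.card_filter, Fintype.sum_sum_type]

/-- **LTZ15 Lemma 8 (decrease clause), PROVED**: for a `(Δ_A, Δ_B)`-biregular (`Δ ≥ 1`)
`(γ_A, δ_A, γ_B, δ_B)`-expanding graph with `δ_A, δ_B < 1/6` and an error `e ∉ C_Z^⊥` with
`|e| ≤ γ_A n_A`, `|e| ≤ γ_B n_B` (so its reduced weight is at most `min(γ_A n_A, γ_B n_B)`), there is a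
vector `e₁` supported inside one generator — a small set `F` — with
`|σ_X(e)| − |σ_X(e + e₁)| ≥ |e₁|/3` ("there exists a critical generator together with a vector `e₁` whose
support is included in the generator, such that `|σ_X(e)| − |σ_X(e+e₁)| ≥ |e₁|/3`"). Proof as printed
(App. B): Hamming-minimal representative of `e + C_Z^⊥` (eq. (reduced): `2|x_a ∪ x_b| ≤ Δ_A + Δ_B`),
critical generator (Lemma 7), eqs. (partial), (partial2), the four cases. The reduced-weight clause
`w_R(e+e₁) ≤ w_R(e)` of the printed lemma is not needed for Theorem 2 and is not asserted.
[cite: LeverrierTillichZemor2015, Lemma 8 (arXiv v1 p0008 L104-110) and App. B (p0013 L10 - p0014 L50)] -/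
theorem exists_smallSet_decrease_third (H : Matrix B A (ZMod 2)) {dA dB : ℕ} {γA δA γB δB : ℝ}
    (hreg : IsBiregular H dA dB) (hexp : IsLeftRightExpanding H dA dB γA δA γB δB)
    (hdA : 0 < dA) (hdB : 0 < dB) (hδA : 0 < δA) (hδA' : δA < 1 / 6) (hδB : 0 < δB) (hδB' : δB < 1 / 6)
    (e : (A × A) ⊕ (B × B) → ZMod 2) (he : e ∉ rowSpace (expanderHZ H))
    (hwA : (hammingNorm e : ℝ) ≤ γA * Fintype.card A) (hwB : (hammingNorm e : ℝ) ≤ γB * Fintype.card B) :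
    ∃ F ∈ smallSets (expanderHZ H),
      (F.card : ℝ) ≤ 3 * syndromeDecrease (expanderHX H) (expanderHX H *ᵥ e) F := by
  classical
  -- Hamming-minimal representative of the coset
  obtain ⟨eR, heR, hmin⟩ := exists_wnorm_min (expanderHZ H) hammingNorm e
  have hsyn : expanderHX H *ᵥ eR = expanderHX H *ᵥ e := by
    have h0 := expanderHX_mulVec_eq_zero_of_mem_rowSpace H heR
    rw [Matrix.mulVec_sub, sub_eq_zero] at h0
    exact h0
  have heR_not : eR ∉ rowSpace (expanderHZ H) := by
    intro h
    apply he
    have : e = eR - (eR - e) := by abel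
    rw [this]
    exact Submodule.sub_mem _ h heR
  have heR0 : (supp eR).Nonempty := by
    by_contra h0
    rw [Finset.not_nonempty_iff_eq_empty] at h0
    apply heR_not
    have hz : eR = 0 := by
      ext q
      by_contra hq
      have : q ∈ supp eR := by simpa [supp] using hq
      rw [h0] at this
      exact Finset.notMem_empty _ this
    rw [hz]; exact Submodule.zero_mem _
  have hsupp : (supp eR).card = hammingNorm eR := by simp [supp, hammingNorm]
  have hle : hammingNorm eR ≤ hammingNorm e := hmin e (by simp)
  have hcardA : ((supp eR).card : ℝ) ≤ γA * Fintype.card A := by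
    rw [hsupp]; exact le_trans (by exact_mod_cast hle) hwA
  have hcardB : ((supp eR).card : ℝ) ≤ γB * Fintype.card B := by
    rw [hsupp]; exact le_trans (by exact_mod_cast hle) hwB
  -- critical generator
  obtain ⟨b, a, Χa, Χb, hc⟩ :=
    exists_isCritical H hreg hexp hdA hdB hδA.le hδB.le (supp eR) heR0 hcardA hcardB
  -- the index sets
  set Xa := critX H eR b a Χa with hXa
  set Yb := critY H eR b a Χb with hYb
  set Xbar := (nbrs Hᵀ b \ Χa).filter fun α => eR (Sum.inl (α, a)) = 0 with hXbar
  set Ybar := (nbrs H a \ Χb).filter fun β => eR (Sum.inr (b, β)) = 0 with hYbar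
  have hXbar_sub : Xbar ⊆ nbrs Hᵀ b := fun α h => (Finset.mem_sdiff.1 (Finset.mem_filter.1 h).1).1
  have hYbar_sub : Ybar ⊆ nbrs H a := fun β h => (Finset.mem_sdiff.1 (Finset.mem_filter.1 h).1).1
  -- row / column sums
  have hXbar' : (nbrs Hᵀ b \ Χa).filter (fun α => ¬ (eR (Sum.inl (α, a)) ≠ 0)) = Xbar :=
    Finset.filter_congr (fun α _ => by rw [not_not])
  have hYbar' : (nbrs H a \ Χb).filter (fun β => ¬ (eR (Sum.inr (b, β)) ≠ 0)) = Ybar :=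
    Finset.filter_congr (fun β _ => by rw [not_not])
  have hΧa_le : Χa.card ≤ dB := by
    have := Finset.card_le_card hc.Χa_subset; rwa [card_nbrs_transpose_eq H hreg b] at this
  have hΧb_le : Χb.card ≤ dA := by
    have := Finset.card_le_card hc.Χb_subset; rwa [card_nbrs_eq H hreg a] at this
  have hrow : (Xa.card : ℝ) + Xbar.card + Χa.card = dB := by
    have h1 : Xa.card + Xbar.card = (nbrs Hᵀ b \ Χa).card := by
      rw [← hXbar', hXa, critX]; exact Finset.card_filter_add_card_filter_not _
    have h2 : (nbrs Hᵀ b \ Χa).card = dB - Χa.card := by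
      rw [Finset.card_sdiff_of_subset hc.Χa_subset, card_nbrs_transpose_eq H hreg b]
    have h3 : ((Xa.card + Xbar.card : ℕ) : ℝ) = ((dB - Χa.card : ℕ) : ℝ) := by rw [h1, h2]
    rw [Nat.cast_sub hΧa_le] at h3; push_cast at h3; linarith
  have hcol : (Yb.card : ℝ) + Ybar.card + Χb.card = dA := by
    have h1 : Yb.card + Ybar.card = (nbrs H a \ Χb).card := by
      rw [← hYbar', hYb, critY]; exact Finset.card_filter_add_card_filter_not _
    have h2 : (nbrs H a \ Χb).card = dA - Χb.card := by
      rw [Finset.card_sdiff_of_subset hc.Χb_subset, card_nbrs_eq H hreg a]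
    have h3 : ((Yb.card + Ybar.card : ℕ) : ℝ) = ((dA - Χb.card : ℕ) : ℝ) := by rw [h1, h2]
    rw [Nat.cast_sub hΧb_le] at h3; push_cast at h3; linarith
  -- integrality of the `χ` bounds: `3|χ_a| + 1 ≤ Δ_B`
  have hZa3 : 3 * (Χa.card : ℝ) + 1 ≤ dB := by
    have h1 : (Χa.card : ℝ) ≤ 2 * δB * dB := hc.card_Χa_le
    have h2 : (3 * Χa.card : ℝ) < dB := by nlinarith [(show (0:ℝ) < dB by exact_mod_cast hdB)]
    have h3 : 3 * Χa.card < dB := by exact_mod_cast h2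
    have h4 : 3 * Χa.card + 1 ≤ dB := h3
    exact_mod_cast h4
  have hZb3 : 3 * (Χb.card : ℝ) + 1 ≤ dA := by
    have h1 : (Χb.card : ℝ) ≤ 2 * δA * dA := hc.card_Χb_le
    have h2 : (3 * Χb.card : ℝ) < dA := by nlinarith [(show (0:ℝ) < dA by exact_mod_cast hdA)]
    have h3 : 3 * Χb.card < dA := by exact_mod_cast h2
    have h4 : 3 * Χb.card + 1 ≤ dA := h3
    exact_mod_cast h4
  -- reducedness: `2 (|x_a| + |x_b|) ≤ Δ_A + Δ_B`
  have hred : 2 * ((Xa.card : ℝ) + Yb.card) ≤ dA + dB := by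
    have hA := cardA_add_row H hreg eR b a
    have hB := cardB_add_row H hreg eR b a
    have hmin' : hammingNorm eR ≤ hammingNorm (eR + expanderHZ H (b, a)) := by
      refine hmin _ ?_
      have : eR + expanderHZ H (b, a) - e = (eR - e) + expanderHZ H (b, a) := by abel
      rw [this]; exact Submodule.add_mem _ heR (expanderHZ_row_mem_rowSpace H b a)
    rw [hammingNorm_eq_cardA_add_cardB, hammingNorm_eq_cardA_add_cardB] at hmin'
    have hXle : Xa.card ≤ ((nbrs Hᵀ b).filter fun α => eR (Sum.inl (α, a)) ≠ 0).card := by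
      refine Finset.card_le_card fun α hα => ?_
      rw [hXa, mem_critX] at hα
      rw [Finset.mem_filter, mem_nbrs, Matrix.transpose_apply]
      exact ⟨hα.1.1, hα.2⟩
    have hYle : Yb.card ≤ ((nbrs H a).filter fun β => eR (Sum.inr (b, β)) ≠ 0).card := by
      refine Finset.card_le_card fun β hβ => ?_
      rw [hYb, mem_critY] at hβ
      rw [Finset.mem_filter, mem_nbrs]
      exact ⟨hβ.1.1, hβ.2⟩
    have : 2 * (Xa.card + Yb.card) ≤ dA + dB := by omega
    exact_mod_cast this
  -- the two decrease bounds
  have hP := syndromeDecrease_critFlip_ge hreg hc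
  rw [hsyn] at hP
  have hQ := syndromeDecrease_flipBar_ge hc
  rw [hsyn] at hQ
  set F := critFlip H eR b a Χa Χb with hF
  set G := Xbar.image (fun α' => (Sum.inl (α', a) : (A × A) ⊕ (B × B)))
    ∪ Ybar.image (fun β' => Sum.inr (b, β')) with hG
  set G' := (nbrs Hᵀ b \ Xbar).image (fun α' => (Sum.inl (α', a) : (A × A) ⊕ (B × B)))
    ∪ (nbrs H a \ Ybar).image (fun β' => Sum.inr (b, β')) with hG'
  set P : ℝ := ((syndromeDecrease (expanderHX H) (expanderHX H *ᵥ e) F : ℤ) : ℝ) with hPdef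
  set Q : ℝ := ((syndromeDecrease (expanderHX H) (expanderHX H *ᵥ e) G : ℤ) : ℝ) with hQdef
  have hP' : (Xa.card : ℝ) * Ybar.card + Xbar.card * Yb.card - Xa.card * Χb.card - Χa.card * Yb.card ≤ P := by
    have h1 : ((Xa.card : ℤ) * ((dA : ℤ) - Χb.card - Yb.card) + ((dB : ℤ) - Χa.card - Xa.card) * Yb.card
        - Xa.card * Χb.card - Χa.card * Yb.card : ℝ)
        ≤ (syndromeDecrease (expanderHX H) (expanderHX H *ᵥ e) F : ℝ) := by exact_mod_cast hP
    have hYbar_e : (Ybar.card : ℝ) = dA - Χb.card - Yb.card := by linarith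
    have hXbar_e : (Xbar.card : ℝ) = dB - Χa.card - Xa.card := by linarith
    rw [hPdef, hYbar_e, hXbar_e]
    push_cast at h1
    linarith
  have hQ' : (Xa.card : ℝ) * Ybar.card + Xbar.card * Yb.card - Xbar.card * Χb.card - Χa.card * Ybar.card
      ≤ Q := by
    rw [hQdef]; exact_mod_cast hQ
  -- the case analysis
  have hcases := ltz_four_cases (P := P) (Q := Q) (by exact_mod_cast hdA) (by exact_mod_cast hdB)
    (Nat.cast_nonneg Xa.card) (Nat.cast_nonneg Xbar.card) (Nat.cast_nonneg Yb.card)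
    (Nat.cast_nonneg Ybar.card) hrow hcol hZa3 hZb3 hred hP' hQ'
  -- `x̄_a ∪ x̄_b` is non-empty (else reducedness fails), and the sizes of the three candidates
  have hbar_pos : (1 : ℝ) ≤ Xbar.card + Ybar.card := by
    by_contra hlt
    push Not at hlt
    have h0 : Xbar.card + Ybar.card = 0 := by
      by_contra hne
      have : 1 ≤ Xbar.card + Ybar.card := Nat.one_le_iff_ne_zero.2 hne
      have : (1 : ℝ) ≤ Xbar.card + Ybar.card := by exact_mod_cast this
      linarith
    have hXb0 : (Xbar.card : ℝ) = 0 := by exact_mod_cast (by omega : Xbar.card = 0)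
    have hYb0 : (Ybar.card : ℝ) = 0 := by exact_mod_cast (by omega : Ybar.card = 0)
    nlinarith
  have hcardF : (F.card : ℝ) = Xa.card + Yb.card := by
    rw [hF]; exact_mod_cast card_critFlip H eR b a Χa Χb
  have hcardG : (G.card : ℝ) = Xbar.card + Ybar.card := by
    rw [hG]; exact_mod_cast card_flipVec_parts b a Xbar Ybar
  have hcardG' : (G'.card : ℝ) = dA + dB - Xbar.card - Ybar.card := by
    have h1 := card_flipVec_parts (A := A) (B := B) b a (nbrs Hᵀ b \ Xbar) (nbrs H a \ Ybar)
    rw [Finset.card_sdiff_of_subset hXbar_sub, Finset.card_sdiff_of_subset hYbar_sub,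
      card_nbrs_transpose_eq H hreg b, card_nbrs_eq H hreg a] at h1
    have hXbar_le : Xbar.card ≤ dB := by
      have := Finset.card_le_card hXbar_sub; rwa [card_nbrs_transpose_eq H hreg b] at this
    have hYbar_le : Ybar.card ≤ dA := by
      have := Finset.card_le_card hYbar_sub; rwa [card_nbrs_eq H hreg a] at this
    rw [hG']
    have h2 : (G'.card : ℝ) = ((dB - Xbar.card + (dA - Ybar.card) : ℕ) : ℝ) := by
      rw [hG']; exact_mod_cast h1
    rw [hG'] at h2
    rw [h2, Nat.cast_add, Nat.cast_sub hXbar_le, Nat.cast_sub hYbar_le]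
    ring
  have hQG' : (syndromeDecrease (expanderHX H) (expanderHX H *ᵥ e) G' : ℝ) = Q := by
    rw [hQdef, hG', hG]
    exact_mod_cast syndromeDecrease_parts_compl H b a (expanderHX H *ᵥ e) hXbar_sub hYbar_sub
  rcases hcases with h | h | h
  · exact ⟨F, critFlip_mem_smallSets hc, by rw [hcardF]; linarith⟩
  · refine ⟨G, ?_, by rw [hcardG]; linarith⟩
    refine flipVec_parts_mem_smallSets H b a hXbar_sub hYbar_sub ?_
    by_contra hne
    rw [not_or, Finset.not_nonempty_iff_eq_empty, Finset.not_nonempty_iff_eq_empty] at hne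
    rw [hne.1, hne.2] at hbar_pos
    norm_num at hbar_pos
  · refine ⟨G', ?_, by rw [hQG', hcardG']; linarith⟩
    refine flipVec_parts_mem_smallSets H b a Finset.sdiff_subset Finset.sdiff_subset ?_
    -- `x_a ∪ x_b ≠ ∅` lies inside the complement flip
    rcases hc.nonempty with ⟨α, hα, hE⟩ | ⟨β, hβ, hE⟩
    · left
      refine ⟨α, Finset.mem_sdiff.2 ⟨(Finset.mem_sdiff.1 hα).1, fun h => ?_⟩⟩
      have := (Finset.mem_filter.1 h).2
      have hne : eR (Sum.inl (α, a)) ≠ 0 := by simpa [supp] using hE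
      exact hne this
    · right
      refine ⟨β, Finset.mem_sdiff.2 ⟨(Finset.mem_sdiff.1 hβ).1, fun h => ?_⟩⟩
      have := (Finset.mem_filter.1 h).2
      have hne : eR (Sum.inr (b, β)) ≠ 0 := by simpa [supp] using hE
      exact hne this


end QuantumExpander

end Literature.InformationTheory.QuantumCodes
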